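import Summits.CriticalPhenomena.PercolationContinuityZ3.Theorems.PercNearOneGluingNoHeavyQuantFarSunCfgCheck
import HarnessLib

/-!
# FAR beyond trees: per-`K` configuration-level certificates — the block pair function as a sum of `4K+10` PRODUCTS

builds on p205010 (kernel theorem, internal audit signed; external expert review pending)

Support file (`--supports stmt-CriticalPhenomena-4575`), seat `prim-cert-1` (gen 26); memo `prim-cert-1/FROM-prim-cert-1-g26-CONFIG-CERTS.md` §7.
`TK.sunFAR_of_fib` (`…QuantFarSunCfgCheck`) reduces `SunFAR K j` to the normalisation check and the nonnegativity of the fibre sums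
`TwoCopy.fib K (TK.Gm … l m u v) z t` of the block pair functions.  To read those sums off big integers (gen 18's Kronecker checker
`TwoCopy.twoCopyKronCheck`, sequel `…QuantFarSunCfgKron`) the block pair function must be a `TwoCopy.pairing`: a sum of products
`t_p(c₁) · a_p(c₂)` with `a_p ≥ 0`.  This file provides that decomposition:
* `TK.NTabs`, `TK.mkNTabs`, `TK.tA/tS/tB` (+ lookup lemmas) — the tables `a`, `Σ_k a_k`, `b` of a mask-level certificate;
* `TK.fwd`, `TK.bwd` — the `K+2` / `K+3` products of `Fm` (copy pays forward / ghost read backward), `TK.fwd_sum`, `TK.bwd_sum`; their factor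
  lists `TK.fwdT/fwdA/bwdT/bwdA` (`fwd_eq_zip`, `bwd_eq_zip`) — the `t`-side depends on one copy's data only, so tables can be shared across blocks;
* `TK.blockTerms` (`4K+10` products), `TK.blockTerms_sum`; `TK.tabulate`; **`TK.pairing_eq_Gm`** — the tabulated products, read as
  `TwoCopy.pairing`, are `TK.Gm` below `2^K`; `TK.fib_congr`;
* `TK.cyA532`, `TK.cyB532`, `TK.rlA`, `TK.rlB` — readers of the certificate classes of the gen-26 LPs (typed `cy532`; reached-set level).
No sorries; standard axioms; nothing here asserts anything about a particular certificate.  Elementary [this work].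
-/

namespace Summit.CriticalPhenomena.PercolationContinuityZ3.Theorems.HairyCycle

namespace TK

open Finset
open Summit.CriticalPhenomena.PercolationContinuityZ3.Theorems.TwoCopy (fib pairing or_lt_two_pow xor_lt_two_pow)

variable {K : ℕ}

/-! ## Tables -/

/-- Tables of a mask-level certificate: `TA[m][m'][q'][k] = am k q' m m'`, `TS[m][m'][q'] = Σ_{k<K} am k q' m m'`,
`TB[m][m'][q'] = bm q' m m'` (`m < K+2`, `m' < K+1`, `q' < 2^K`, `k < K`). [this work] -/
structure NTabs where
  /-- `a` table -/
  TA : Array (Array (Array (Array ℕ)))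
  /-- `Σ_k a_k` table -/
  TS : Array (Array (Array ℕ))
  /-- `b` table -/
  TB : Array (Array (Array ℕ))

/-- Building the tables. [this work] -/
def mkNTabs (K : ℕ) (am : ℕ → ℕ → ℕ → ℕ → ℕ) (bm : ℕ → ℕ → ℕ → ℕ) : NTabs where
  TA := Array.ofFn fun m : Fin (K + 2) => Array.ofFn fun m' : Fin (K + 1) => Array.ofFn fun q : Fin (2 ^ K) =>
    Array.ofFn fun k : Fin K => am k q m m'
  TS := Array.ofFn fun m : Fin (K + 2) => Array.ofFn fun m' : Fin (K + 1) => Array.ofFn fun q : Fin (2 ^ K) =>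
    ∑ k ∈ range K, am k q m m'
  TB := Array.ofFn fun m : Fin (K + 2) => Array.ofFn fun m' : Fin (K + 1) => Array.ofFn fun q : Fin (2 ^ K) => bm q m m'

/-- Lookup `a`. [this work] -/
def tA (t : NTabs) (m m' q k : ℕ) : ℕ := (((t.TA.getD m #[]).getD m' #[]).getD q #[]).getD k 0
/-- Lookup `Σ_k a_k`. [this work] -/
def tS (t : NTabs) (m m' q : ℕ) : ℕ := ((t.TS.getD m #[]).getD m' #[]).getD q 0
/-- Lookup `b`. [this work] -/
def tB (t : NTabs) (m m' q : ℕ) : ℕ := ((t.TB.getD m #[]).getD m' #[]).getD q 0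

/-- `getD` of `Array.ofFn` in range. [folklore] -/
theorem getD_ofFn {α : Type} {n : ℕ} (f : Fin n → α) (d : α) {i : ℕ} (hi : i < n) :
    (Array.ofFn f).getD i d = f ⟨i, hi⟩ := by
  simp [Array.getD, hi]

variable {am : ℕ → ℕ → ℕ → ℕ → ℕ} {bm : ℕ → ℕ → ℕ → ℕ} {j : ℕ}

/-- Table `a` is `am`. [this work] -/
theorem tA_mk {m m' q k : ℕ} (hm : m < K + 2) (hm' : m' < K + 1) (hq : q < 2 ^ K) (hk : k < K) :
    tA (mkNTabs K am bm) m m' q k = am k q m m' := by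
  unfold tA mkNTabs
  rw [getD_ofFn _ _ hm, getD_ofFn _ _ hm', getD_ofFn _ _ hq, getD_ofFn _ _ hk]

/-- Table `Σ a` is `Σ_k am`. [this work] -/
theorem tS_mk {m m' q : ℕ} (hm : m < K + 2) (hm' : m' < K + 1) (hq : q < 2 ^ K) :
    tS (mkNTabs K am bm) m m' q = ∑ k ∈ range K, am k q m m' := by
  unfold tS mkNTabs
  rw [getD_ofFn _ _ hm, getD_ofFn _ _ hm', getD_ofFn _ _ hq]

/-- Table `b` is `bm`. [this work] -/
theorem tB_mk {m m' q : ℕ} (hm : m < K + 2) (hm' : m' < K + 1) (hq : q < 2 ^ K) :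
    tB (mkNTabs K am bm) m m' q = bm q m m' := by
  unfold tB mkNTabs
  rw [getD_ofFn _ _ hm, getD_ofFn _ _ hm', getD_ofFn _ _ hq]

/-! ## Product decompositions of the pair function -/

/-- `Fm` expanded. [this work] -/
theorem Fm_expand (K j : ℕ) (am : ℕ → ℕ → ℕ → ℕ → ℕ) (bm : ℕ → ℕ → ℕ → ℕ) (r q g g' : ℕ) :
    Fm K j am bm r q g g' = (if pc r ≤ j then (0 : ℤ) else 1) * (∑ k ∈ range K, (am k q g g' : ℤ)) +
      (∑ k ∈ range K, (if r.testBit k then (-1 : ℤ) else 0) * (am k q g g' : ℤ)) +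
      (2 * (j : ℤ) - (pc r : ℤ)) * (bm q g g' : ℤ) := by
  unfold Fm
  have e1 : ∀ k ∈ range K, (am k q g g' : ℤ) * ((if r.testBit k then (0 : ℤ) else 1) - (if pc r ≤ j then 1 else 0)) =
      (if pc r ≤ j then (0 : ℤ) else 1) * (am k q g g' : ℤ) + (if r.testBit k then (-1 : ℤ) else 0) * (am k q g g' : ℤ) := by
    intro k _
    split <;> split <;> ring
  rw [sum_congr rfl e1, sum_add_distrib, ← mul_sum]
  ring

/-- `k`-th forward `t`-function: `−𝟙[k ∈ r₁]` (`r₁ = c₁ ∧ M`). [this work] -/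
def fwdTk (M k : ℕ) : ℕ → ℤ := fun c1 => if (c1 &&& M).testBit k then -1 else 0
/-- `k`-th forward `a`-function: `a_k(c₂)`. [this work] -/
def fwdAk (t : NTabs) (g g' k : ℕ) : ℕ → ℕ := fun c2 => tA t g g' c2 k
/-- The `k`-th forward product: `−𝟙[k ∈ r₁] · a_k(c₂)`. [this work] -/
def fwdK (M : ℕ) (t : NTabs) (g g' k : ℕ) : (ℕ → ℤ) × (ℕ → ℕ) := (fwdTk M k, fwdAk t g g' k)

/-- Forward `t`-functions (they depend on the copy's coverage mask `M` only). [this work] -/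
def fwdT (K j M : ℕ) : List (ℕ → ℤ) :=
  (fun c1 => if pc (c1 &&& M) ≤ j then (0 : ℤ) else 1) ::
    ((List.ofFn fun k : Fin K => fwdTk M k) ++ [fun c1 => 2 * (j : ℤ) - (pc (c1 &&& M) : ℤ)])
/-- Forward `a`-functions (they depend on the ghost's extent `(g, g')` only). [this work] -/
def fwdA (K : ℕ) (t : NTabs) (g g' : ℕ) : List (ℕ → ℕ) :=
  (fun c2 => tS t g g' c2) :: ((List.ofFn fun k : Fin K => fwdAk t g g' k) ++ [fun c2 => tB t g g' c2])

/-- FORWARD decomposition of `Fm` (copy 1 = `c₁` with coverage mask `M`, ghost = `c₂` at `(g, g')`): the `K+2` products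
`(1−𝟙[n₁≤j])·Σa(c₂)`, `−𝟙[k ∈ r₁]·a_k(c₂)`, `(2j−n₁)·b(c₂)`. [this work] -/
def fwd (K j M : ℕ) (t : NTabs) (g g' : ℕ) : List ((ℕ → ℤ) × (ℕ → ℕ)) :=
  ((fun c1 => if pc (c1 &&& M) ≤ j then (0 : ℤ) else 1), fun c2 => tS t g g' c2) ::
    ((List.ofFn fun k : Fin K => fwdK M t g g' k) ++ [((fun c1 => 2 * (j : ℤ) - (pc (c1 &&& M) : ℤ)), fun c2 => tB t g g' c2)])

/-- `k`-th backward `t`-function: `−a_k(c₁)`. [this work] -/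
def bwdTk (t : NTabs) (g g' k : ℕ) : ℕ → ℤ := fun c1 => -(tA t g g' c1 k : ℤ)
/-- `k`-th backward `a`-function: `𝟙[k ∈ r₂]` (`r₂ = c₂ ∧ M'`). [this work] -/
def bwdAk (M' k : ℕ) : ℕ → ℕ := fun c2 => if (c2 &&& M').testBit k then 1 else 0
/-- The `k`-th backward product: `−a_k(c₁) · 𝟙[k ∈ r₂]`. [this work] -/
def bwdK (M' : ℕ) (t : NTabs) (g g' k : ℕ) : (ℕ → ℤ) × (ℕ → ℕ) := (bwdTk t g g' k, bwdAk M' k)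

/-- Backward `t`-functions (they depend on the ghost's extent `(g, g')` only). [this work] -/
def bwdT (K j : ℕ) (t : NTabs) (g g' : ℕ) : List (ℕ → ℤ) :=
  (fun c1 => (tS t g g' c1 : ℤ)) ::
    ((List.ofFn fun k : Fin K => bwdTk t g g' k) ++ [fun c1 => -(tB t g g' c1 : ℤ), fun c1 => 2 * (j : ℤ) * (tB t g g' c1 : ℤ)])
/-- Backward `a`-functions (they depend on the copy's coverage mask `M'` only). [this work] -/
def bwdA (K j M' : ℕ) : List (ℕ → ℕ) :=
  (fun c2 => if pc (c2 &&& M') ≤ j then 0 else 1) ::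
    ((List.ofFn fun k : Fin K => bwdAk M' k) ++ [fun c2 => pc (c2 &&& M'), fun _ => 1])

/-- BACKWARD decomposition of `Fm` (copy = `c₂` with coverage mask `M'`, ghost = `c₁` at `(g, g')`): the `K+3` products
`Σa(c₁)·(1−𝟙[n₂≤j])`, `−a_k(c₁)·𝟙[k ∈ r₂]`, `−b(c₁)·n₂`, `2j·b(c₁)·1`. [this work] -/
def bwd (K j M' : ℕ) (t : NTabs) (g g' : ℕ) : List ((ℕ → ℤ) × (ℕ → ℕ)) :=
  ((fun c1 => (tS t g g' c1 : ℤ)), fun c2 => if pc (c2 &&& M') ≤ j then 0 else 1) ::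
    ((List.ofFn fun k : Fin K => bwdK M' t g g' k) ++
      [((fun c1 => -(tB t g g' c1 : ℤ)), fun c2 => pc (c2 &&& M')), ((fun c1 => 2 * (j : ℤ) * (tB t g g' c1 : ℤ)), fun _ => 1)])

/-- `zip` of two `ofFn`s. [folklore] -/
theorem zip_ofFn {α β : Type} {n : ℕ} (f : Fin n → α) (g : Fin n → β) :
    List.zip (List.ofFn f) (List.ofFn g) = List.ofFn fun i => (f i, g i) := by
  apply List.ext_getElem
  · simp
  · intro i h1 h2
    simp

/-- `fwd` is the `zip` of its `t`- and `a`-functions. [this work] -/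
theorem fwd_eq_zip (K j M : ℕ) (t : NTabs) (g g' : ℕ) : fwd K j M t g g' = List.zip (fwdT K j M) (fwdA K t g g') := by
  unfold fwd fwdT fwdA
  rw [List.zip_cons_cons, List.zip_append (by simp), zip_ofFn]
  rfl

/-- `bwd` is the `zip` of its `t`- and `a`-functions. [this work] -/
theorem bwd_eq_zip (K j M' : ℕ) (t : NTabs) (g g' : ℕ) : bwd K j M' t g g' = List.zip (bwdT K j t g g') (bwdA K j M') := by
  unfold bwd bwdT bwdA
  rw [List.zip_cons_cons, List.zip_append (by simp), zip_ofFn]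
  rfl

/-- Value of a product term at `(c₁, c₂)`. [this work] -/
def termVal (c1 c2 : ℕ) (x : (ℕ → ℤ) × (ℕ → ℕ)) : ℤ := x.1 c1 * (x.2 c2 : ℤ)

/-- Sum of the values of an `ofFn` term list. [this work] -/
theorem sum_ofFn_termVal (K : ℕ) (c1 c2 : ℕ) (f : ℕ → (ℕ → ℤ) × (ℕ → ℕ)) :
    ((List.ofFn fun k : Fin K => f k).map (termVal c1 c2)).sum = ∑ k ∈ range K, termVal c1 c2 (f k) := by
  rw [List.map_ofFn, List.sum_ofFn, Finset.sum_range]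
  rfl

/-- The forward products sum to `Fm`. [this work] -/
theorem fwd_sum (K j M : ℕ) {g g' c2 : ℕ} (hg : g < K + 2) (hg' : g' < K + 1) (hc2 : c2 < 2 ^ K) (c1 : ℕ) :
    ((fwd K j M (mkNTabs K am bm) g g').map (termVal c1 c2)).sum = Fm K j am bm (c1 &&& M) c2 g g' := by
  unfold fwd
  rw [List.map_cons, List.sum_cons, List.map_append, List.sum_append, sum_ofFn_termVal]
  simp only [List.map_cons, List.map_nil, List.sum_cons, List.sum_nil, add_zero, termVal, fwdK, fwdTk, fwdAk]
  have e1 : ∀ k ∈ range K, (if (c1 &&& M).testBit k then (-1 : ℤ) else 0) * (tA (mkNTabs K am bm) g g' c2 k : ℤ) =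
      (if (c1 &&& M).testBit k then (-1 : ℤ) else 0) * (am k c2 g g' : ℤ) := fun k hk => by
    rw [tA_mk hg hg' hc2 (mem_range.1 hk)]
  rw [sum_congr rfl e1, tS_mk hg hg' hc2, tB_mk hg hg' hc2, Fm_expand]
  push_cast
  ring

/-- The backward products sum to `Fm` (with the roles of the copies exchanged). [this work] -/
theorem bwd_sum (K j M' : ℕ) {g g' c1 : ℕ} (hg : g < K + 2) (hg' : g' < K + 1) (hc1 : c1 < 2 ^ K) (c2 : ℕ) :
    ((bwd K j M' (mkNTabs K am bm) g g').map (termVal c1 c2)).sum = Fm K j am bm (c2 &&& M') c1 g g' := by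
  unfold bwd
  rw [List.map_cons, List.sum_cons, List.map_append, List.sum_append, sum_ofFn_termVal]
  simp only [List.map_cons, List.map_nil, List.sum_cons, List.sum_nil, add_zero, termVal, bwdK, bwdTk, bwdAk]
  have e1 : ∀ k ∈ range K, -(tA (mkNTabs K am bm) g g' c1 k : ℤ) * ((if (c2 &&& M').testBit k then 1 else 0 : ℕ) : ℤ) =
      (if (c2 &&& M').testBit k then (-1 : ℤ) else 0) * (am k c1 g g' : ℤ) := fun k hk => by
    rw [tA_mk hg hg' hc1 (mem_range.1 hk)]
    split <;> simp
  rw [sum_congr rfl e1, tS_mk hg hg' hc1, tB_mk hg hg' hc1, Fm_expand]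
  push_cast
  split <;> ring

/-! ## The block terms -/

/-- The `4K+10` product terms of the block `(l, m, u, v)`. [this work] -/
def blockTerms (K j : ℕ) (t : NTabs) (l m u v : ℕ) : List ((ℕ → ℤ) × (ℕ → ℕ)) :=
  fwd K j (covM K l u) t m v ++ bwd K j (covM K m v) t l u ++ (fwd K j (covM K l v) t m u ++ bwd K j (covM K m u) t l v)

/-- The block terms sum to the block pair function. [this work] -/
theorem blockTerms_sum (K j : ℕ) {l m u v c1 c2 : ℕ} (hl : l < K + 2) (hm : m < K + 2) (hu : u < K + 1) (hv : v < K + 1)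
    (hc1 : c1 < 2 ^ K) (hc2 : c2 < 2 ^ K) :
    ((blockTerms K j (mkNTabs K am bm) l m u v).map (termVal c1 c2)).sum = Gm K j am bm l m u v c1 c2 := by
  unfold blockTerms Gm
  rw [List.map_append, List.map_append, List.map_append, List.sum_append, List.sum_append, List.sum_append,
    fwd_sum K j _ hm hv hc2, bwd_sum K j _ hl hu hc1, fwd_sum K j _ hm hu hc2, bwd_sum K j _ hl hv hc1]

/-- Tabulating a function on `[0, N)`. [this work] -/
def tabulate {α : Type} (N : ℕ) (f : ℕ → α) : List α := (List.range N).map f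

/-! ## The products read as `TwoCopy.pairing` -/

/-- Reading a tabulated term list. [this work] -/
theorem getD_tabulate {α : Type} [Zero α] (L : List ((ℕ → ℤ) × (ℕ → ℕ))) (sel : (ℕ → ℤ) × (ℕ → ℕ) → ℕ → α) {N c : ℕ} (hc : c < N)
    (p : ℕ) : ((L.map fun x => tabulate N (sel x)).getD p []).getD c 0 = (L.map fun x => sel x c).getD p 0 := by
  simp only [List.getD_eq_getElem?_getD, List.getElem?_map]
  cases L[p]? with
  | none => simp
  | some x => simp [tabulate, hc]

/-- `Σ_{p < |L|} f(L)_p · g(L)_p` as a list sum. [this work] -/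
theorem sum_range_getD_mul (L : List ((ℕ → ℤ) × (ℕ → ℕ))) (c1 c2 : ℕ) :
    ∑ p ∈ range L.length, (L.map fun x => x.1 c1).getD p 0 * (((L.map fun x => x.2 c2).getD p 0 : ℕ) : ℤ) =
      (L.map (termVal c1 c2)).sum := by
  induction L with
  | nil => simp
  | cons x L ih =>
    rw [List.length_cons, sum_range_succ']
    simp only [List.map_cons, List.getD_cons_succ, List.getD_cons_zero, List.sum_cons]
    rw [ih, add_comm]
    rfl

/-- `fib` only reads the pair function below `2^m`. [this work] -/
theorem fib_congr {m : ℕ} {G G' : ℕ → ℕ → ℤ} (h : ∀ c1 c2, c1 < 2 ^ m → c2 < 2 ^ m → G c1 c2 = G' c1 c2) {z t : ℕ}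
    (hz : z < 2 ^ m) (ht : t < 2 ^ m) : fib m G z t = fib m G' z t := by
  unfold fib
  refine sum_congr rfl fun jm hjm => ?_
  rw [mem_filter, mem_range] at hjm
  exact h _ _ (or_lt_two_pow hz hjm.1) (or_lt_two_pow hz (xor_lt_two_pow ht hjm.1))

/-- **The tabulated products are the block pair function** below `2^K`. [this work] -/
theorem pairing_eq_Gm (K j : ℕ) {l m u v : ℕ} (hl : l < K + 2) (hm : m < K + 2) (hu : u < K + 1) (hv : v < K + 1)
    {c1 c2 : ℕ} (hc1 : c1 < 2 ^ K) (hc2 : c2 < 2 ^ K) :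
    let L := blockTerms K j (mkNTabs K am bm) l m u v
    pairing L.length (fun p c => ((L.map fun x => tabulate (2 ^ K) x.1).getD p []).getD c 0)
      (fun c => (List.replicate (2 ^ K) (0 : ℤ)).getD c 0)
      (fun p c => ((L.map fun x => tabulate (2 ^ K) x.2).getD p []).getD c 0)
      (fun c => (List.replicate (2 ^ K) (0 : ℕ)).getD c 0) c1 c2 = Gm K j am bm l m u v c1 c2 := by
  intro L
  unfold pairing
  dsimp only
  have h0 : (List.replicate (2 ^ K) (0 : ℤ)).getD c1 0 = 0 := by
    rw [List.getD_eq_getElem?_getD, List.getElem?_replicate]; split <;> rfl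
  rw [h0, zero_mul, sub_zero]
  rw [sum_congr rfl fun p _ => by rw [getD_tabulate L (fun x => x.1) hc1 p, getD_tabulate L (fun x => x.2) hc2 p],
    sum_range_getD_mul, blockTerms_sum K j hl hm hu hv hc1 hc2]

/-! ## Typed certificate readers of the gen-26 LP certificates -/

/-- Typed `a`-multiplier of class `cy532` read from a radix table over (status of `k` ∈ {reached, dud, uncovered}, region ∈ {P, S, M},
`min(dist to end, 2)`, `min(#reached, 5)`, `min(#duds, 3)`, full-coverage flag) — `3·3·3·6·4·2 = 1296` slots. [this work] -/
def cyA532 (K : ℕ) (tab : Array ℕ) (k q m m' : ℕ) : ℕ :=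
  let cm := covM K m m'
  let full : Bool := cm == 2 ^ K - 1
  let r := q &&& cm
  let dd := cm ^^^ r
  let st : ℕ := if r.testBit k then 0 else if dd.testBit k then 1 else 2
  let rg : ℕ := if full then 0 else if k < m then 0 else if m' ≤ k then 1 else 2
  let dn := min (min k (K - 1 - k)) 2
  tab.getD (((((st * 3 + rg) * 3 + dn) * 6 + min (pc r) 5) * 4 + min (pc dd) 3) * 2 + (if full then 1 else 0)) 0

/-- Typed `b`-multiplier of class `cy532` (radix table over `min(#reached, 5)`, `min(#duds, 3)`, full flag — `48` slots). [this work] -/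
def cyB532 (K : ℕ) (tab : Array ℕ) (q m m' : ℕ) : ℕ :=
  let cm := covM K m m'
  let full : Bool := cm == 2 ^ K - 1
  let r := q &&& cm
  let dd := cm ^^^ r
  tab.getD ((min (pc r) 5 * 4 + min (pc dd) 3) * 2 + (if full then 1 else 0)) 0


/-- Reached-set-level `a`-multiplier read from a dense table `tab[k·2^K + r']`, `r' = q' ∧ covM` the ghost's reached mask. [this work] -/
def rlA (K : ℕ) (tab : Array ℕ) (k q m m' : ℕ) : ℕ := tab.getD (k * 2 ^ K + (q &&& covM K m m')) 0

/-- Reached-set-level `b`-multiplier read from a dense table `tab[r']`. [this work] -/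
def rlB (K : ℕ) (tab : Array ℕ) (q m m' : ℕ) : ℕ := tab.getD (q &&& covM K m m') 0

end TK

end Summit.CriticalPhenomena.PercolationContinuityZ3.Theorems.HairyCycle
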